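/-
Copyright (c) 2026 the pub-hodgecm-mathlib formalisation cell (harness21).  Prover seat hodgecm-mathlib-LH4-p08 (g9), req620 Track A «(D-RAM) FOUR-FRAME» squad, helper lane
on h413 = stmt-HodgeConjecture-24833 (count-neutral).  STAGE-1b, row (2), RamM lane of the (LAW) END — dealer LH4-plan (g13) WORD #100 (R0), second hand to LH4-p07 (g9).  2026-09-04.
-/
import Summits.HodgeConjecture.HodgeConjecture.Theorems.F0P3cDyRamToricLevelCensusRamMTwoMult   -- ★ p858944 (LH4-p04 (g6)): the EVEN-depth two-multiplier cell; brings ★ RamMDep (D0), ★ T4c `forall_dual_mul_mem_iff`, ★ DEFS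
import HarnessLib

/-!
# Crux `H413`, line LH4 «(D-RAM) FOUR-FRAME» — STAGE-1b, row (2): (R0) «THE ODD-DEPTH MULTIPLIER IN THE RAMIFIED FRAME PASSES EXACTLY THE DEEP CELLS»
# `|μ| = |ϖE|^m·|α| = exp(−(2m + 1))` ⇒ (`μ·Λ^♯ ⊆ Λ` ⟺ `j + a ≤ m`) on `levelSet(j, a)`; hence `levelSetDep(j,a;μ₁) ∩ {Λ ∣ μ·Λ^♯ ⊆ Λ} = [j + a ≤ m]·levelSetDep(j,a;μ₁)`

Cell `hodgecm-mathlib` (D-0151), FLOOR 0, crux item H413 = `stmt-HodgeConjecture-24833`, route of record `HCCMUnconditional`; squad F0∕P3c∕LH4 (req618∕req620); helper lane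
`--supports stmt-HodgeConjecture-24833 --as helper` (count-neutral).  THEOREMS ONLY (no `def`, no instance, no notation, no `sorry`; default heartbeats).

THE GAP (LH4-p07 (g9) SCOPE-RamM-lane v1 48fdfff2 row (R0); dealer WORD #100).  In the M∕E-RAMIFIED frame (`(M, ρ, α, d_ρ)` a ★ ramified quadratic datum: `|α| = exp(−1)`,
`|α − ρα| = exp(−d_ρ)`; `ϖE` `ρ`-fixed with `|ϖE| = exp(−2)`) every ★ depth rule of the level census — ★ (D0) `dep_iff_of_witness_ramified`, ★ p858944's two-multiplier cells, hence
★ p859305 ∕ ★ p860481 §1∕§2 — reads a multiplier of EVEN valuation `|μ| = |ϖE|^m`.  The RamM level socket's SQUARE multiplier `μ₂ = (ιϖ^b)⁻¹(λ − ιu₀)(λ + ιu₀ − 2)` has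
`|λ + ιu₀ − 2| = exp(−kν)` of EITHER parity near `1`, so on the odd-`kν` population `|μ₂| = exp(−(2m₂ + 1))` and no ★ rule applied.
THE ANSWER (this file): AN ODD-DEPTH MULTIPLIER SEES NO TWIST.  By ★ T4c `forall_dual_mul_mem_iff` the depth clause of a presented member `Λ = x₀·𝒪_j` of `levelSet(j, a)` is
`μ∕y ∈ 𝒪_j` (`y` the dual generator, `|y| = |ϖE|^a`).  When `|μ∕y| = exp(−(2k + 1))` is ODD, `μ∕y = ϖE^k·(α·z)` with `z` a unit, and `α·z − ρ(α·z) = α(z − ρz) + (α − ρα)·ρz` has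
valuation EXACTLY `exp(−d_ρ)` (the first term is `≤ exp(−1 − d_ρ)` by the integral basis, ★ `hint`) — so `|μ∕y − ρ(μ∕y)| = exp(−2k − d_ρ)` is RIGID (no unit can be closer to the
fixed line), and `μ∕y ∈ 𝒪_j ⟺ a ≤ m ∧ j ≤ m − a`.  No guard, no class letter, no sign cell: the odd-depth clause is the «deep clause» alone.
* §1 `v_sub_map_eq_of_v_odd_ramified` — `|w| = exp(−(2k+1)) ⇒ |w − ρw| = exp(−(2k + d_ρ))`.
* §2 **`dep_iff_of_witness_ramified_odd`** — the (D0)-odd sentence (LH4-p07 (g9)'s (R0a) contract 13:35:15Z, token `hμ : |μ| = |ϖE|^m·|α|`): `(∀ b ∈ Λ^♯, μb ∈ Λ) ⟺ j + a ≤ m`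
  — the proof DECIDES the guard: the expected twist disjunct `∨ |…| ≤ exp(2m + 1 − 2a − 2j − dρ)` is EMPTY (§1), only the deep clause survives.
* §3 **`levelSetDep_eq_of_ramified_odd`** (`levelSetDep(j,a;μ) = if j + a ≤ m then levelSet(j,a) else ∅`), **`levelSetDep_inter_depth_eq_ramified_odd`** (★ p858944's (T5-P) spelling
  with the second multiplier odd: `= if j + a ≤ m then levelSetDep(j,a;μ₁) else ∅`, ANY first multiplier `μ₁`), `levelSetDep_inter_levelSetDep_eq_ramified_odd`, the counted form
  `ncard_levelSetDep_inter_eq_ramified_odd` and the weighted forms **`finsum_mem_levelSetDep_inter_depth_eq_ramified_odd`** ∕ **`finsum_mem_inter_levelSetDep_eq_ramified_odd`** ((R0b), p07's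
  name: ★ p858944's head with `hμ₂ : |μ₂| = |ϖE|^{m₂}·|α|`; `G′ j a := j + a ≤ m₂` — a letter of `(j, a, m₂)` alone, so NO `hμ₁`∕`hle` binder is needed and μ₁ is arbitrary) — the `hcell`
  letters ★ p860481 §1∕§2 consume from ★ p858944, now for the odd-`kν` population: the guard `[j + b′ ≤ m₂ ∨ …]` becomes the bare cutoff `[j + b′ ≤ m₂]`.
HONEST LABEL.  Count-neutral lattice bookkeeping; nothing printed is asserted; no census law is stated; `HC_CM` is proved only modulo the 7 printed citations (2 remaining named inputs:
hLiu418 = `stmt-HodgeConjecture-24832`, h413 = `stmt-HodgeConjecture-24833`) until rung 0 closes.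

## References
* [Serre1979] J.-P. Serre, *Local Fields*, GTM 67 (1979): Ch. II §1 (distinct valuations do not cancel), Ch. III §6 Prop. 12 (orders of conductor `c` in a quadratic extension),
  Ch. IV §1 Prop. 3–4 (the different bound `|z − ρz| ≤ |α − ρα|` on integers).
* [Jacobowitz1962] R. Jacobowitz, *Hermitian forms over local fields*, Amer. J. Math. 84 (1962): §4 (dual lattices `Λ^♯ = y⁻¹Λ`; the depth condition `μΛ^♯ ⊆ Λ`).
* [Kottwitz1986BaseChangeUnits] R. E. Kottwitz, *Base change for unit elements of Hecke algebras*, Compositio Math. 60 (1986): §1 pp. 240–241 (fixed-lattice counts with the tube condition).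
-/

set_option autoImplicit false

noncomputable section

namespace Summit.HodgeConjecture.HodgeConjecture.Cruxes.H413.F0P3cDyRamToricLevelCensusRamMOddDepth

open WithZero
open Literature.NumberTheory.Automorphic.UnitaryThreeFourFrame (IsRamifiedQuadraticDatum)
open Literature.NumberTheory.LocalFields.QuadraticOrder
open Summit.HodgeConjecture.HodgeConjecture.Cruxes.H413.F0P3cDyRamToricCensusDefs
open Summit.HodgeConjecture.HodgeConjecture.Cruxes.H413.F0P3cDyRamToricLevelCensusRamM (v_sub_map_eq_exp_of_datum map_ne_self_of_datum v_sub_map_div_le_one_of_datum)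

variable {K : Type} [Field K] [Valued K ℤᵐ⁰] {ρ Θ : K →+* K} {α ϖE h : K} {dρ t : ℕ}

/-! ## §1 An element of ODD valuation is moved by exactly `d_ρ` -/

/-- **ODD VALUATION IS RIGID UNDER `ρ`.**  In the ramified frame, `|w| = exp(−(2k + 1))` ⇒ `|w − ρw| = exp(−(2k + d_ρ))`: write `w = ϖE^k·(α·z)` with `z` a unit; then
`αz − ρ(αz) = α(z − ρz) + (α − ρα)·ρz` with `|α(z − ρz)| ≤ exp(−1 − d_ρ) < exp(−d_ρ) = |(α − ρα)·ρz|`. [cite: Serre1979, Ch. II §1; Ch. IV §1 Prop. 3–4] -/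
theorem v_sub_map_eq_of_v_odd_ramified (hD : IsRamifiedQuadraticDatum ρ α dρ t) (hρϖ : ρ ϖE = ϖE) (hϖE : Valued.v ϖE = exp (-2 : ℤ))
    {w : K} {k : ℕ} (hw : Valued.v w = exp (-(2 * (k : ℤ) + 1))) : Valued.v (w - ρ w) = exp (-(2 * (k : ℤ) + dρ)) := by
  obtain ⟨hρρ, hvρ, hα, -, -, -, -⟩ := id hD
  have hδ := v_sub_map_eq_exp_of_datum hD
  have hint := v_sub_map_div_le_one_of_datum hD
  have hα0 : α ≠ 0 := fun h0 => by rw [h0, map_zero] at hα; exact (exp_ne_zero hα.symm).elim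
  have hϖ0 : ϖE ≠ 0 := fun h0 => by rw [h0, map_zero] at hϖE; exact (exp_ne_zero hϖE.symm).elim
  have hδ0 : α - ρ α ≠ 0 := sub_ne_zero.2 (Ne.symm (map_ne_self_of_datum hD))
  -- the unit `z := w ∕ (ϖE^k·α)`
  set z : K := w / (ϖE ^ k * α) with hz
  have hcz : ϖE ^ k * α ≠ 0 := mul_ne_zero (pow_ne_zero _ hϖ0) hα0
  have hwz : w = ϖE ^ k * (α * z) := by rw [hz]; field_simp
  have hz1 : Valued.v z = 1 := by
    rw [hz, map_div₀, map_mul, map_pow, hw, hϖE, hα, ← exp_nsmul, ← exp_add, nsmul_eq_mul, div_eq_one_iff_eq exp_ne_zero]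
    congr 1; ring
  have hzρ : Valued.v (z - ρ z) ≤ exp (-(dρ : ℤ)) := by
    have h1 := hint z hz1.le
    rw [map_div₀, div_le_one₀ (zero_lt_iff.2 ((Valuation.ne_zero_iff _).2 hδ0)), hδ] at h1
    exact h1
  -- `αz − ρ(αz) = α(z − ρz) + (α − ρα)·ρz`, two terms of DISTINCT valuation
  have hsplit : α * z - ρ (α * z) = α * (z - ρ z) + (α - ρ α) * ρ z := by rw [map_mul]; ring
  have hbig : Valued.v ((α - ρ α) * ρ z) = exp (-(dρ : ℤ)) := by rw [map_mul, hδ, hvρ, hz1, mul_one]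
  have hsmall : Valued.v (α * (z - ρ z)) < Valued.v ((α - ρ α) * ρ z) := by
    rw [hbig, map_mul, hα]
    calc exp (-1 : ℤ) * Valued.v (z - ρ z) ≤ exp (-1 : ℤ) * exp (-(dρ : ℤ)) := mul_le_mul_right hzρ _
      _ = exp (-1 + -(dρ : ℤ)) := (exp_add _ _).symm
      _ < exp (-(dρ : ℤ)) := by rw [exp_lt_exp]; omega
  have hαz : Valued.v (α * z - ρ (α * z)) = exp (-(dρ : ℤ)) := by
    rw [hsplit, Valuation.map_add_eq_of_lt_right _ hsmall, hbig]
  rw [hwz, map_mul ρ, map_pow ρ, hρϖ, ← mul_sub, map_mul, map_pow, hϖE, hαz, ← exp_nsmul, ← exp_add, nsmul_eq_mul]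
  congr 1; ring

/-! ## §2 (D0)-odd: the depth clause of an odd-depth multiplier on a presented lattice -/

/-- **(D0)-ODD — AN ODD-DEPTH MULTIPLIER PASSES EXACTLY THE DEEP CELLS.**  For a presented member `Λ = x₀·𝒪_j` of `levelSet(j, a)` (`|dualGen x₀| = |ϖE|^a`) and a multiplier
of ODD valuation `|μ| = exp(−(2m + 1))`:  `(∀ b ∈ Λ^♯, μ·b ∈ Λ) ⟺ j + a ≤ m` — ★ T4c `forall_dual_mul_mem_iff` (`⟺ μ∕y ∈ 𝒪_j`) and §1 on `μ∕y` (`|μ∕y| = exp(−(2(m−a)+1))`: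
integral iff `a ≤ m`, and then `|μ∕y − ρ(μ∕y)| = exp(−2(m−a) − d_ρ) ≤ exp(−2j − d_ρ)` iff `j ≤ m − a`).  Compare ★ (D0) `dep_iff_of_witness_ramified` (even depth: a twist ball appears).
[cite: Jacobowitz1962, §4] [cite: Serre1979, Ch. III §6 Prop. 12; Ch. IV §1 Prop. 3–4] [cite: Kottwitz1986BaseChangeUnits, §1 pp. 240–241] -/
theorem dep_iff_of_witness_ramified_odd (hD : IsRamifiedQuadraticDatum ρ α dρ t) (hΘΘ : ∀ x, Θ (Θ x) = x) (hΘρ : ∀ x, Θ (ρ x) = ρ (Θ x))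
    (hvΘ : ∀ x, Valued.v (Θ x) = Valued.v x) (hρϖ : ρ ϖE = ϖE) (hϖE : Valued.v ϖE = exp (-2 : ℤ)) (hh : h ≠ 0)
    {μ : K} {m : ℕ} (hμ : Valued.v μ = Valued.v ϖE ^ m * Valued.v α) {j a : ℕ} {Λ : AddSubgroup K} {x₀ : K} (hx₀ : x₀ ≠ 0)
    (hΛ : ∀ x, x ∈ Λ ↔ ∃ z, IsOrd ρ α (ϖE ^ j) z ∧ x = x₀ * z) (hya : Valued.v (dualGen ρ Θ α (ϖE ^ j) h x₀) = Valued.v ϖE ^ a) :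
    (∀ b, (∀ x ∈ Λ, Valued.v (h * Θ x * b + ρ (h * Θ x * b)) ≤ 1) → μ * b ∈ Λ) ↔ j + a ≤ m := by
  obtain ⟨hρρ, hvρ, hα, -, -, -, -⟩ := id hD
  have hμ' : Valued.v μ = exp (-(2 * (m : ℤ) + 1)) := by
    rw [hμ, hα, v_varpiE_pow hϖE, ← exp_add]; congr 1; ring
  have hρα := map_ne_self_of_datum hD
  have hδ := v_sub_map_eq_exp_of_datum hD
  have hint := v_sub_map_div_le_one_of_datum hD
  have hα1 : Valued.v α ≤ 1 := by rw [hα, ← exp_zero, exp_le_exp]; norm_num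
  have hϖ0 : ϖE ≠ 0 := fun h0 => by rw [h0, map_zero] at hϖE; exact (exp_ne_zero hϖE.symm).elim
  have hc : ρ (ϖE ^ j) = ϖE ^ j := by rw [map_pow, hρϖ]
  have hc0 : ϖE ^ j ≠ 0 := pow_ne_zero _ hϖ0
  have hc1 : Valued.v (ϖE ^ j) ≤ 1 := by rw [map_pow, hϖE]; exact pow_le_one₀ zero_le (by rw [← exp_zero, exp_le_exp]; norm_num)
  simp only [dualGen] at hya
  rw [forall_dual_mul_mem_iff hρρ hvρ hρα hα1 hint hΘΘ hΘρ hvΘ hc hc0 hc1 hh hx₀ hΛ μ]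
  have hy0 : h * (x₀ * Θ x₀) * (ϖE ^ j * (α - ρ α)) ≠ 0 := fun h0 => by
    rw [h0, map_zero, v_varpiE_pow hϖE] at hya; exact (exp_ne_zero hya.symm).elim
  have hvy : Valued.v (μ / (h * (x₀ * Θ x₀) * (ϖE ^ j * (α - ρ α)))) = exp (2 * (a : ℤ) - (2 * m + 1)) := by
    rw [map_div₀, hya, hμ', v_varpiE_pow hϖE, ← exp_sub]; congr 1; ring
  have hcond : Valued.v (ϖE ^ j * (α - ρ α)) = exp (-(2 * (j : ℤ) + dρ)) := v_conductorR hδ hϖE j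
  constructor
  · rintro ⟨h1, h2⟩
    have ham : a ≤ m := by rw [hvy, ← exp_zero, exp_le_exp] at h1; omega
    have hvy' : Valued.v (μ / (h * (x₀ * Θ x₀) * (ϖE ^ j * (α - ρ α)))) = exp (-(2 * ((m - a : ℕ) : ℤ) + 1)) := by
      rw [hvy]; congr 1; push_cast [Nat.cast_sub ham]; ring
    rw [v_sub_map_eq_of_v_odd_ramified hD hρϖ hϖE hvy', hcond, exp_le_exp] at h2
    omega
  · intro hjam
    have ham : a ≤ m := by omega
    have hvy' : Valued.v (μ / (h * (x₀ * Θ x₀) * (ϖE ^ j * (α - ρ α)))) = exp (-(2 * ((m - a : ℕ) : ℤ) + 1)) := by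
      rw [hvy]; congr 1; push_cast [Nat.cast_sub ham]; ring
    refine ⟨by rw [hvy, ← exp_zero, exp_le_exp]; omega, ?_⟩
    rw [v_sub_map_eq_of_v_odd_ramified hD hρϖ hϖE hvy', hcond, exp_le_exp]
    omega

/-! ## §3 The cells of an odd-depth multiplier, alone and next to another multiplier -/

/-- **THE ODD-DEPTH ROW OF THE RamM TABLE**: `levelSetDep(j,a;μ) = if j + a ≤ m then levelSet(j,a) else ∅` for `|μ| = exp(−(2m+1))` (§2 on a witness of each member).
[cite: Jacobowitz1962, §4] [cite: Kottwitz1986BaseChangeUnits, §1 pp. 240–241] -/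
theorem levelSetDep_eq_of_ramified_odd (hD : IsRamifiedQuadraticDatum ρ α dρ t) (hΘΘ : ∀ x, Θ (Θ x) = x) (hΘρ : ∀ x, Θ (ρ x) = ρ (Θ x))
    (hvΘ : ∀ x, Valued.v (Θ x) = Valued.v x) (hρϖ : ρ ϖE = ϖE) (hϖE : Valued.v ϖE = exp (-2 : ℤ)) (hh : h ≠ 0)
    {μ : K} {m : ℕ} (hμ : Valued.v μ = Valued.v ϖE ^ m * Valued.v α) (j a : ℕ) :
    levelSetDep ρ Θ α ϖE h j a μ = if j + a ≤ m then levelSet ρ Θ α ϖE h j a else ∅ := by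
  ext Λ
  rw [mem_levelSetDep_iff]
  constructor
  · rintro ⟨hΛ, hdep⟩
    obtain ⟨x₀, hx₀, hΛx, hyO, hyN, hya⟩ := hΛ
    have hjam := (dep_iff_of_witness_ramified_odd hD hΘΘ hΘρ hvΘ hρϖ hϖE hh hμ hx₀ hΛx hya).1 hdep
    rw [if_pos hjam]
    exact ⟨x₀, hx₀, hΛx, hyO, hyN, hya⟩
  · intro hΛ
    split_ifs at hΛ with hjam
    · obtain ⟨x₀, hx₀, hΛx, hyO, hyN, hya⟩ := hΛ
      exact ⟨⟨x₀, hx₀, hΛx, hyO, hyN, hya⟩, (dep_iff_of_witness_ramified_odd hD hΘΘ hΘρ hvΘ hρϖ hϖE hh hμ hx₀ hΛx hya).2 hjam⟩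
    · exact absurd hΛ (Set.notMem_empty Λ)

/-- **THE TWO-MULTIPLIER CELL WITH AN ODD-DEPTH SECOND MULTIPLIER, (T5-P) SPELLING** (★ p858944 `levelSetDep_inter_depth_eq_ramified`'s odd twin): for ANY first multiplier
`μ₁` and `|μ₂| = exp(−(2m₂ + 1))`, `levelSetDep(j,a;μ₁) ∩ {Λ ∣ μ₂·Λ^♯ ⊆ Λ} = if j + a ≤ m₂ then levelSetDep(j,a;μ₁) else ∅` — the guard of the even case degenerates to the cutoff.
[cite: Kottwitz1986BaseChangeUnits, §1 pp. 240–241] [cite: Jacobowitz1962, §4] -/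
theorem levelSetDep_inter_depth_eq_ramified_odd (hD : IsRamifiedQuadraticDatum ρ α dρ t) (hΘΘ : ∀ x, Θ (Θ x) = x) (hΘρ : ∀ x, Θ (ρ x) = ρ (Θ x))
    (hvΘ : ∀ x, Valued.v (Θ x) = Valued.v x) (hρϖ : ρ ϖE = ϖE) (hϖE : Valued.v ϖE = exp (-2 : ℤ)) (hh : h ≠ 0)
    (μ₁ : K) {μ₂ : K} {m₂ : ℕ} (hμ₂ : Valued.v μ₂ = Valued.v ϖE ^ m₂ * Valued.v α) (j a : ℕ) :
    levelSetDep ρ Θ α ϖE h j a μ₁ ∩ {Λ | ∀ b, (∀ x ∈ Λ, Valued.v (h * Θ x * b + ρ (h * Θ x * b)) ≤ 1) → μ₂ * b ∈ Λ} =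
      if j + a ≤ m₂ then levelSetDep ρ Θ α ϖE h j a μ₁ else ∅ := by
  ext Λ
  simp only [Set.mem_inter_iff, Set.mem_setOf_eq, mem_levelSetDep_iff]
  constructor
  · rintro ⟨⟨hΛ, hdep₁⟩, hdep₂⟩
    obtain ⟨x₀, hx₀, hΛx, hyO, hyN, hya⟩ := hΛ
    have hjam := (dep_iff_of_witness_ramified_odd hD hΘΘ hΘρ hvΘ hρϖ hϖE hh hμ₂ hx₀ hΛx hya).1 hdep₂
    rw [if_pos hjam, mem_levelSetDep_iff]
    exact ⟨⟨x₀, hx₀, hΛx, hyO, hyN, hya⟩, hdep₁⟩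
  · intro hΛ
    split_ifs at hΛ with hjam
    · rw [mem_levelSetDep_iff] at hΛ
      obtain ⟨hΛ, hdep₁⟩ := hΛ
      obtain ⟨x₀, hx₀, hΛx, hyO, hyN, hya⟩ := hΛ
      exact ⟨⟨⟨x₀, hx₀, hΛx, hyO, hyN, hya⟩, hdep₁⟩, (dep_iff_of_witness_ramified_odd hD hΘΘ hΘρ hvΘ hρϖ hϖE hh hμ₂ hx₀ hΛx hya).2 hjam⟩
    · exact absurd hΛ (Set.notMem_empty Λ)

/-- The set form with both cells spelled as `levelSetDep`: `levelSetDep(j,a;μ₁) ∩ levelSetDep(j,a;μ₂) = if j + a ≤ m₂ then levelSetDep(j,a;μ₁) else ∅` (`|μ₂|` odd).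
[cite: Kottwitz1986BaseChangeUnits, §1 pp. 240–241] -/
theorem levelSetDep_inter_levelSetDep_eq_ramified_odd (hD : IsRamifiedQuadraticDatum ρ α dρ t) (hΘΘ : ∀ x, Θ (Θ x) = x) (hΘρ : ∀ x, Θ (ρ x) = ρ (Θ x))
    (hvΘ : ∀ x, Valued.v (Θ x) = Valued.v x) (hρϖ : ρ ϖE = ϖE) (hϖE : Valued.v ϖE = exp (-2 : ℤ)) (hh : h ≠ 0)
    (μ₁ : K) {μ₂ : K} {m₂ : ℕ} (hμ₂ : Valued.v μ₂ = Valued.v ϖE ^ m₂ * Valued.v α) (j a : ℕ) :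
    levelSetDep ρ Θ α ϖE h j a μ₁ ∩ levelSetDep ρ Θ α ϖE h j a μ₂ = if j + a ≤ m₂ then levelSetDep ρ Θ α ϖE h j a μ₁ else ∅ := by
  rw [← levelSetDep_inter_depth_eq_ramified_odd hD hΘΘ hΘρ hvΘ hρϖ hϖE hh μ₁ hμ₂ j a]
  ext Λ
  simp only [Set.mem_inter_iff, Set.mem_setOf_eq, mem_levelSetDep_iff]
  exact ⟨fun ⟨⟨hΛ, h1⟩, _, h2⟩ => ⟨⟨hΛ, h1⟩, h2⟩, fun ⟨⟨hΛ, h1⟩, h2⟩ => ⟨⟨hΛ, h1⟩, hΛ, h2⟩⟩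

/-- The counted form: `#(levelSetDep(j,a;μ₁) ∩ levelSetDep(j,a;μ₂)) = if j + a ≤ m₂ then #levelSetDep(j,a;μ₁) else 0` (`|μ₂|` odd). [cite: Flicker1998UnitaryFL, Prop. 7 p. 84] -/
theorem ncard_levelSetDep_inter_eq_ramified_odd (hD : IsRamifiedQuadraticDatum ρ α dρ t) (hΘΘ : ∀ x, Θ (Θ x) = x) (hΘρ : ∀ x, Θ (ρ x) = ρ (Θ x))
    (hvΘ : ∀ x, Valued.v (Θ x) = Valued.v x) (hρϖ : ρ ϖE = ϖE) (hϖE : Valued.v ϖE = exp (-2 : ℤ)) (hh : h ≠ 0)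
    (μ₁ : K) {μ₂ : K} {m₂ : ℕ} (hμ₂ : Valued.v μ₂ = Valued.v ϖE ^ m₂ * Valued.v α) (j a : ℕ) :
    (levelSetDep ρ Θ α ϖE h j a μ₁ ∩ levelSetDep ρ Θ α ϖE h j a μ₂).ncard = if j + a ≤ m₂ then (levelSetDep ρ Θ α ϖE h j a μ₁).ncard else 0 := by
  rw [levelSetDep_inter_levelSetDep_eq_ramified_odd hD hΘΘ hΘρ hvΘ hρϖ hϖE hh μ₁ hμ₂ j a]
  split_ifs
  · rfl
  · exact Set.ncard_empty _

/-! ## §4 The weighted cells (the `Σᶠ` currency of ★ (C1) ∕ ★ p860481 §1∕§2) -/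

/-- **THE WEIGHTED TWO-MULTIPLIER CONE CELL WITH AN ODD-DEPTH SECOND MULTIPLIER, (T5-P) SPELLING** (★ p858944 `finsum_mem_levelSetDep_inter_depth_eq_ramified`'s odd twin — the
`hcell` letter of ★ p860481 §1∕§2 on the odd-`kν` population): for ANY weight `f` and ANY first multiplier `μ₁`, `|μ₂| = exp(−(2m₂ + 1))`:
`Σᶠ_{Λ ∈ levelSetDep(j,a;μ₁) ∩ {Λ ∣ μ₂·Λ^♯ ⊆ Λ}} f Λ = if j + a ≤ m₂ then Σᶠ_{Λ ∈ levelSetDep(j,a;μ₁)} f Λ else 0`.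
[cite: Kottwitz1986BaseChangeUnits, §1 pp. 240–241] [cite: Jacobowitz1962, §4] -/
theorem finsum_mem_levelSetDep_inter_depth_eq_ramified_odd (hD : IsRamifiedQuadraticDatum ρ α dρ t) (hΘΘ : ∀ x, Θ (Θ x) = x) (hΘρ : ∀ x, Θ (ρ x) = ρ (Θ x))
    (hvΘ : ∀ x, Valued.v (Θ x) = Valued.v x) (hρϖ : ρ ϖE = ϖE) (hϖE : Valued.v ϖE = exp (-2 : ℤ)) (hh : h ≠ 0)
    (μ₁ : K) {μ₂ : K} {m₂ : ℕ} (hμ₂ : Valued.v μ₂ = Valued.v ϖE ^ m₂ * Valued.v α) (j a : ℕ)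
    {M : Type*} [AddCommMonoid M] (f : AddSubgroup K → M) :
    ∑ᶠ Λ ∈ levelSetDep ρ Θ α ϖE h j a μ₁ ∩ {Λ | ∀ b, (∀ x ∈ Λ, Valued.v (h * Θ x * b + ρ (h * Θ x * b)) ≤ 1) → μ₂ * b ∈ Λ}, f Λ =
      if j + a ≤ m₂ then ∑ᶠ Λ ∈ levelSetDep ρ Θ α ϖE h j a μ₁, f Λ else 0 := by
  rw [levelSetDep_inter_depth_eq_ramified_odd hD hΘΘ hΘρ hvΘ hρϖ hϖE hh μ₁ hμ₂ j a]
  split_ifs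
  · rfl
  · exact finsum_mem_empty

/-- The weighted cell with both cells spelled as `levelSetDep`. [cite: Kottwitz1986BaseChangeUnits, §1 pp. 240–241] -/
theorem finsum_mem_inter_levelSetDep_eq_ramified_odd (hD : IsRamifiedQuadraticDatum ρ α dρ t) (hΘΘ : ∀ x, Θ (Θ x) = x) (hΘρ : ∀ x, Θ (ρ x) = ρ (Θ x))
    (hvΘ : ∀ x, Valued.v (Θ x) = Valued.v x) (hρϖ : ρ ϖE = ϖE) (hϖE : Valued.v ϖE = exp (-2 : ℤ)) (hh : h ≠ 0)
    (μ₁ : K) {μ₂ : K} {m₂ : ℕ} (hμ₂ : Valued.v μ₂ = Valued.v ϖE ^ m₂ * Valued.v α) (j a : ℕ)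
    {M : Type*} [AddCommMonoid M] (f : AddSubgroup K → M) :
    ∑ᶠ Λ ∈ levelSetDep ρ Θ α ϖE h j a μ₁ ∩ levelSetDep ρ Θ α ϖE h j a μ₂, f Λ =
      if j + a ≤ m₂ then ∑ᶠ Λ ∈ levelSetDep ρ Θ α ϖE h j a μ₁, f Λ else 0 := by
  rw [levelSetDep_inter_levelSetDep_eq_ramified_odd hD hΘΘ hΘρ hvΘ hρϖ hϖE hh μ₁ hμ₂ j a]
  split_ifs
  · rfl
  · exact finsum_mem_empty

end Summit.HodgeConjecture.HodgeConjecture.Cruxes.H413.F0P3cDyRamToricLevelCensusRamMOddDepth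

end
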